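import Literature.NumberTheory.QuadraticForms.LocalNormIndex
import HarnessLib

/-!
# The local norm index of a quadratic algebra `K_v(√θ) ∕ K_v`: `2` at the non-split places, `1` at the split ones, and the count
# `∏_{v ∈ S} [K_vˣ : N] = 2^{#{v ∈ S non-split}}` (O'Meara §63:13a; Rogawski (1990) §3.5–3.6: `|H¹(F_v, T)|` for the tori of `U(3)`)

Topic `NumberTheory/QuadraticForms`; namespace `Literature.NumberTheory.QuadraticForms`; THEOREMS ONLY (no definition, no instance, no named
fact, no `sorry`).  PACKAGING over ★ `index_quadraticNormSubgroup_adicCompletion_eq_two` (index `2` for `θ` a non-square in `K_v`) and ★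
`quadraticNormSubgroup_eq_top_of_isSquare` (everything is a norm when `θ` is a square): the DICHOTOMY `[K_vˣ : N(K_v(√θ)ˣ)] ∈ {1, 2}` read by
`IsSquare (θ : K_v)`, the power-of-two form, and the product over a finite set of places — the shape in which the T1 engine line's pre-stabilisation
(G6, row R5 «CartanLocalIndex») counts `|H¹(F_v, T_γ)| = ∏_{w ∣ v} [K_wˣ : N((K E)_wˣ)] = 2^{#{w ∣ v non-split}}` factor by factor over the étale
algebra `K = ∏ Kᵢ` of a regular `γ` ([Rogawski1990, §3.5 p. 29, §3.6]).

* `index_quadraticNormSubgroup_adicCompletion_eq_one_of_isSquare` — split: index `1`;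
* `index_quadraticNormSubgroup_adicCompletion_eq_two_iff` ∕ `_eq_one_iff` — the dichotomy read by `IsSquare θ`;
* `index_quadraticNormSubgroup_adicCompletion_dvd_two`, `…_pos`, `…_le_two`;
* `index_quadraticNormSubgroup_adicCompletion_eq_two_pow` — `= 2 ^ (if IsSquare θ then 0 else 1)`;
* **`prod_index_quadraticNormSubgroup_adicCompletion_eq_two_pow_card`** — `∏_{v ∈ S} index = 2 ^ #{v ∈ S | ¬ IsSquare (θ : K_v)}`.

## References
* O. T. O'Meara, *Introduction to Quadratic Forms* (1963), §63B Prop. 63:13a [Omeara1963].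
* J. D. Rogawski, *Automorphic Representations of Unitary Groups in Three Variables*, Ann. of Math. Stud. 123 (1990), §3.5 p. 29, §3.6 p. 31
  [Rogawski1990].
-/

set_option autoImplicit false

noncomputable section

open NumberField IsDedekindDomain

namespace Literature.NumberTheory.QuadraticForms

variable (K : Type) [Field K] [NumberField K] (v : HeightOneSpectrum (𝓞 K))

/-- **Split ⇒ index 1**: if `θ` is a non-zero square in `K_v` then every unit of `K_v` is a norm from `K_v(√θ) ≅ K_v × K_v`.
[cite: Omeara1963, §63B Prop. 63:13a] -/
theorem index_quadraticNormSubgroup_adicCompletion_eq_one_of_isSquare {a : v.adicCompletion K} (ha0 : a ≠ 0) (ha : IsSquare a) :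
    (quadraticNormSubgroup (v.adicCompletion K) a).index = 1 := by
  haveI : CharZero (v.adicCompletion K) := charZero_of_injective_algebraMap (algebraMap K _).injective
  haveI : NeZero (2 : v.adicCompletion K) := ⟨two_ne_zero⟩
  rw [quadraticNormSubgroup_eq_top_of_isSquare ha ha0, Subgroup.index_top]

/-- **The dichotomy**: for `θ ≠ 0` in `K_v`, `[K_vˣ : N] = 2 ↔ θ` is not a square. [cite: Omeara1963, §63B Prop. 63:13a] -/
theorem index_quadraticNormSubgroup_adicCompletion_eq_two_iff {a : v.adicCompletion K} (ha0 : a ≠ 0) :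
    (quadraticNormSubgroup (v.adicCompletion K) a).index = 2 ↔ ¬ IsSquare a := by
  refine ⟨fun h hsq => ?_, index_quadraticNormSubgroup_adicCompletion_eq_two K v ha0⟩
  rw [index_quadraticNormSubgroup_adicCompletion_eq_one_of_isSquare K v ha0 hsq] at h
  exact absurd h (by norm_num)

/-- `[K_vˣ : N] = 1 ↔ θ` is a square (`θ ≠ 0`). [cite: Omeara1963, §63B Prop. 63:13a] -/
theorem index_quadraticNormSubgroup_adicCompletion_eq_one_iff {a : v.adicCompletion K} (ha0 : a ≠ 0) :
    (quadraticNormSubgroup (v.adicCompletion K) a).index = 1 ↔ IsSquare a := by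
  refine ⟨fun h => ?_, index_quadraticNormSubgroup_adicCompletion_eq_one_of_isSquare K v ha0⟩
  by_contra hsq
  rw [index_quadraticNormSubgroup_adicCompletion_eq_two K v ha0 hsq] at h
  exact absurd h (by norm_num)

/-- **Power-of-two form**: `[K_vˣ : N(K_v(√θ)ˣ)] = 2 ^ (if θ is a square then 0 else 1)`. [cite: Omeara1963, §63B Prop. 63:13a]
[cite: Rogawski1990, §3.6 p. 31] -/
theorem index_quadraticNormSubgroup_adicCompletion_eq_two_pow {a : v.adicCompletion K} (ha0 : a ≠ 0) [Decidable (IsSquare a)] :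
    (quadraticNormSubgroup (v.adicCompletion K) a).index = 2 ^ (if IsSquare a then 0 else 1) := by
  split_ifs with h
  · rw [pow_zero]; exact index_quadraticNormSubgroup_adicCompletion_eq_one_of_isSquare K v ha0 h
  · rw [pow_one]; exact index_quadraticNormSubgroup_adicCompletion_eq_two K v ha0 h

/-- `[K_vˣ : N] ∣ 2`. [cite: Omeara1963, §63B Prop. 63:13a] -/
theorem index_quadraticNormSubgroup_adicCompletion_dvd_two {a : v.adicCompletion K} (ha0 : a ≠ 0) :
    (quadraticNormSubgroup (v.adicCompletion K) a).index ∣ 2 := by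
  by_cases h : IsSquare a
  · rw [index_quadraticNormSubgroup_adicCompletion_eq_one_of_isSquare K v ha0 h]; exact one_dvd 2
  · rw [index_quadraticNormSubgroup_adicCompletion_eq_two K v ha0 h]

/-- `0 < [K_vˣ : N]` (the norm subgroup has finite index). [cite: Omeara1963, §63B Prop. 63:13a] -/
theorem index_quadraticNormSubgroup_adicCompletion_pos {a : v.adicCompletion K} (ha0 : a ≠ 0) :
    0 < (quadraticNormSubgroup (v.adicCompletion K) a).index :=
  Nat.pos_of_dvd_of_pos (index_quadraticNormSubgroup_adicCompletion_dvd_two K v ha0) two_pos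

/-- `[K_vˣ : N] ≤ 2`. [cite: Omeara1963, §63B Prop. 63:13a] -/
theorem index_quadraticNormSubgroup_adicCompletion_le_two {a : v.adicCompletion K} (ha0 : a ≠ 0) :
    (quadraticNormSubgroup (v.adicCompletion K) a).index ≤ 2 :=
  Nat.le_of_dvd two_pos (index_quadraticNormSubgroup_adicCompletion_dvd_two K v ha0)

/-- **The norm subgroup has finite index** (so `Nat.card (K_vˣ ⧸ N) = [K_vˣ : N]` is an honest cardinality). [cite: Omeara1963, §63B Prop. 63:13a] -/
theorem finiteIndex_quadraticNormSubgroup_adicCompletion {a : v.adicCompletion K} (ha0 : a ≠ 0) :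
    (quadraticNormSubgroup (v.adicCompletion K) a).FiniteIndex :=
  ⟨(index_quadraticNormSubgroup_adicCompletion_pos K v ha0).ne'⟩

/-- **The count over a finite set of places**: for `θ ∈ K` non-zero and a finite set `S` of finite places of `K`,
`∏_{v ∈ S} [K_vˣ : N(K_v(√θ)ˣ)] = 2 ^ #{v ∈ S | θ is not a square in K_v}` — Rogawski's `|H¹(F_v, T)| = 2^{#non-split}` count for the norm-one
tori of a quadratic extension, place by place. [cite: Rogawski1990, §3.5 p. 29; §3.6 p. 31] [cite: Omeara1963, §63B Prop. 63:13a] -/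
theorem prod_index_quadraticNormSubgroup_adicCompletion_eq_two_pow_card {θ : K} (hθ : θ ≠ 0) (S : Finset (HeightOneSpectrum (𝓞 K)))
    [DecidablePred fun v : HeightOneSpectrum (𝓞 K) => IsSquare (algebraMap K (v.adicCompletion K) θ)] :
    ∏ v ∈ S, (quadraticNormSubgroup (v.adicCompletion K) (algebraMap K (v.adicCompletion K) θ)).index =
      2 ^ (S.filter fun v => ¬ IsSquare (algebraMap K (v.adicCompletion K) θ)).card := by
  have hθv : ∀ v : HeightOneSpectrum (𝓞 K), algebraMap K (v.adicCompletion K) θ ≠ 0 := fun v =>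
    (map_ne_zero_iff _ (algebraMap K (v.adicCompletion K)).injective).2 hθ
  rw [Finset.card_filter, ← Finset.prod_pow_eq_pow_sum]
  refine Finset.prod_congr rfl fun v _ => ?_
  by_cases h : IsSquare (algebraMap K (v.adicCompletion K) θ)
  · rw [if_neg (not_not_intro h), pow_zero, index_quadraticNormSubgroup_adicCompletion_eq_one_of_isSquare K v (hθv v) h]
  · rw [if_pos h, pow_one, index_quadraticNormSubgroup_adicCompletion_eq_two K v (hθv v) h]

end Literature.NumberTheory.QuadraticForms

end
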